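import Summits.CriticalPhenomena.PercolationContinuityZ3.Theorems.PercNearOneGluingNoHeavyLowerTailSunflowerMultiPetalKempeMarkedExpansion
import HarnessLib
import HarnessLib.Audit

/-!
# `NoHeavyLowerTail` (crux stmt-CriticalPhenomena-4575), marked-multigraph layer: the CELLS of the neighbourhood-contraction step law

Support file (seat `prim-l12-p2` gen 47; `--supports stmt-CriticalPhenomena-4575`; continuation of `…KempeMarkedExpansion` (p595201) and of the finite cores
`…KempeNeighbourhoodContraction` (p593133)).  No `sorry`; nothing is asserted about the crux.
Memo: run/shared/lean/prim/prim-l12/prim-l12-p2/FINDING-g47-NEIGHBOURHOOD-CONTRACTION-STEP.md §3, §6.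

THE HEART OF THEOREM L1 in the same-vertex-type formalization (memo §6, 'cell injection' plan): for terminals `u ≠ v`, a non-terminal `y` and the set `S`
of its other neighbours, every colouring `ρ` of `V` with the terminal colours is a CELL with residual
`resCell ρ = kerTAbs (type_{K−y} ρ) (profile_y ρ) − [ρ ≡ 0 on S]·fC (type_{K−y} ρ)`, and
* `sum_resCell_eq`:  **`Σ_ρ resCell ρ = (3·T(K) − T(K.isolate y)) − allZeroSum`**, where `allZeroSum = Σ_ρ [ρ ≡ 0 on S]·fC(type_{K−y} ρ)` is (up to the factor
  `3^{|S|+1}` of the isolated vertices) `T` of the contracted graph `(K−y)/(S∪u → u)` — so THEOREM L1 is `0 ≤ Σ_ρ resCell ρ`;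
* `resCell_nonneg_of_profile`: the residual is `≥ 0` at every cell whose profile is none of the seven defect profiles (the all-`0` cells being repaired by the
  contraction kernel, `kerTAbs_sub_fC_nonneg_of_all_zero`).  The remaining cells are the four deficit families D1, D2, D4, D5 of the memo, to be charged to
  payer cells by an explicit injection (sequel).
* `sum_eq_three_mul_sum_extCol`: a colouring functional that ignores the colour of `y` sums to `3 ×` its sum over the colourings of `V ∖ {y}`.
-/

namespace Summit.CriticalPhenomena.PercolationContinuityZ3.Theorems.SunflowerPartition.Kempe

open Finset

namespace MGraph

variable {V : Type*} [Fintype V] [LinearOrder V] (K : MGraph V)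

/-! ## Cells of the neighbourhood-contraction law (same vertex type) -/

section Cells

variable (y : V) (S : Finset V)

/-- The CELL RESIDUAL of the neighbourhood-contraction law at a colouring `ρ` of `V` (the colour of `y` is irrelevant):
`kerTAbs (type_{K−y} ρ) (profile_y ρ) − [ρ ≡ 0 on S]·fC (type_{K−y} ρ)` (memo §3, `R₁`). [this work] -/
def resCell (ρ : V → Fin 3) : ℤ :=
  kerTAbs ((K.isolate y).ctypeM ρ) (K.profM y ρ) - (if ∀ s ∈ S, ρ s = 0 then fC ((K.isolate y).ctypeM ρ) else 0)

/-- The all-`0` cell sum `Σ_{ρ u = 0, ρ v = 1} [ρ ≡ 0 on S]·fC (type_{K−y} ρ)` — `3^{|S|+1}` times this is `T` of the contracted graph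
`(K−y)/(S∪u → u)` realised as `K.peelContract y S u` (to be proved in the assembly file). [this work] -/
def allZeroSum (u v : V) : ℤ :=
  ∑ ρ ∈ univ.filter (fun ρ : V → Fin 3 => ρ u = 0 ∧ ρ v = 1), (if ∀ s ∈ S, ρ s = 0 then fC ((K.isolate y).ctypeM ρ) else 0)

/-- A function of colourings that ignores the colour of `y` sums to three times its sum over the colourings of `V ∖ {y}`. [this work] -/
theorem sum_eq_three_mul_sum_extCol (u v : ({y}ᶜ : Set V)) (G : (V → Fin 3) → ℤ) (hG : ∀ τ : (({y}ᶜ : Set V)) → Fin 3, ∀ c, G (extCol y τ c) = G (extCol y τ 0)) :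
    ∑ ρ ∈ univ.filter (fun ρ : V → Fin 3 => ρ u.1 = 0 ∧ ρ v.1 = 1), G ρ
      = 3 * ∑ τ ∈ univ.filter (fun τ : (({y}ᶜ : Set V)) → Fin 3 => τ u = 0 ∧ τ v = 1), G (extCol y τ 0) := by
  rw [sum_filter, sum_filter, mul_sum]
  have hR : ∀ τ : (({y}ᶜ : Set V)) → Fin 3,
      3 * (if τ u = 0 ∧ τ v = 1 then G (extCol y τ 0) else 0) = ∑ c : Fin 3, (if τ u = 0 ∧ τ v = 1 then G (extCol y τ c) else 0) := by
    intro τ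
    rw [Fin.sum_univ_three, hG τ 1, hG τ 2]
    by_cases h : τ u = 0 ∧ τ v = 1
    · simp only [if_pos h]; ring
    · simp only [if_neg h]; ring
  rw [sum_congr rfl (fun τ _ => hR τ), ← Fintype.sum_prod_type']
  refine sum_nbij' (fun σ => (σ ∘ Subtype.val, σ y)) (fun p => extCol y p.1 p.2) (by simp) (by simp)
    (fun σ _ => extCol_restrict y σ) (fun p _ => Prod.ext (extCol_comp_val y p.1 p.2) (extCol_self y p.1 p.2))
    (fun σ _ => ?_)
  dsimp only
  exact if_congr Iff.rfl (by rw [extCol_restrict]) rfl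

/-- **THE CELL IDENTITY**: `Σ_ρ resCell = (3·T(K) − T(K.isolate y)) − allZeroSum` over the colourings with the terminal colours (`y ∉ {u,v}`). [this work] -/
theorem sum_resCell_eq (u v : ({y}ᶜ : Set V)) :
    ∑ ρ ∈ univ.filter (fun ρ : V → Fin 3 => ρ u.1 = 0 ∧ ρ v.1 = 1), K.resCell y S ρ
      = (3 * K.TfunM u.1 v.1 - (K.isolate y).TfunM u.1 v.1) - K.allZeroSum y S u.1 v.1 := by
  unfold resCell allZeroSum
  rw [sum_sub_distrib, K.three_mul_TfunM_sub_TfunM_isolate y u v]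
  congr 1
  refine sum_eq_three_mul_sum_extCol y u v _ (fun τ c => ?_)
  rw [K.ctypeM_isolate_extCol y τ c 0, K.profM_extCol y τ c 0]

/-- Off the seven small/boundary profiles the cell residual is nonnegative.  Hypotheses (all automatic when `S = N(y) ∖ {u,v}` is nonempty, see the
pattern lemmas of the sequel): the profile has a `0`-neighbour (`y ∼ u`), is none of the seven defect profiles of `kerTAbs_neg_profiles_of_two_le`, the
profile `(2,0,0)` forces the all-`0` cell, and in the all-`0` cell the profile is `(2, k₁, 0)`. [this work] -/
theorem resCell_nonneg_of_profile (ρ : V → Fin 3) (h1 : (K.profM y ρ).1 ≠ 0)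
    (hk : K.profM y ρ ≠ (1, 0, 0) ∧ K.profM y ρ ≠ (1, 0, 1) ∧ K.profM y ρ ≠ (1, 1, 0) ∧ K.profM y ρ ≠ (1, 0, 2) ∧
      K.profM y ρ ≠ (1, 2, 0) ∧ K.profM y ρ ≠ (2, 0, 1) ∧ K.profM y ρ ≠ (2, 1, 0))
    (hall : K.profM y ρ = (2, 0, 0) → ∀ s ∈ S, ρ s = 0)
    (hzero : (∀ s ∈ S, ρ s = 0) → (K.profM y ρ).1 = 2 ∧ (K.profM y ρ).2.2 = 0) : 0 ≤ K.resCell y S ρ := by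
  unfold resCell
  by_cases hA : ∀ s ∈ S, ρ s = 0
  · rw [if_pos hA]
    obtain ⟨ha, hc⟩ := hzero hA
    have hprof : K.profM y ρ = (2, (K.profM y ρ).2.1, 0) :=
      Prod.ext ha (Prod.ext rfl hc)
    rw [hprof]
    exact kerTAbs_sub_fC_nonneg_of_all_zero _ _
  · rw [if_neg hA, sub_zero]
    by_contra hneg
    push Not at hneg
    rcases kerTAbs_neg_profiles_of_two_le _ _ h1 hk.1 hk.2.1 hk.2.2.1 hneg with h | h | h | h | h
    · exact hk.2.2.2.1 h
    · exact hk.2.2.2.2.1 h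
    · exact hk.2.2.2.2.2.1 h
    · exact hk.2.2.2.2.2.2 h
    · exact hA (hall h)

end Cells

end MGraph

end Summit.CriticalPhenomena.PercolationContinuityZ3.Theorems.SunflowerPartition.Kempe
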